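import Summits.QuantumFields.BalabanUV.Beta.FP.SliceVertex

/-!
# `BalabanUV.Beta.FP.SliceVertex2` — road «FP» for binder row D1, row H2V-2 part 3 (owner b2b-balaban-beta-d1-p3 «GO sliceW4», CLAIMS 2026-08-21 l.28064 (1)):
# THE BACKGROUND-FEYNMAN SLICE `−½Σ τ((D*_B W)²)` AT SECOND ORDER IN THE BACKGROUND — the second-order transport word, the `(2,2)` jet (polarised), its two-bond
# Hessian vertex `sliceVertex₂` in colour coordinates, and the colourless two-bond entry `sEntry₂` in closed form (part 4 = `FP/SliceBiStencil`: the packed bi-table `sliceW`)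

HONEST DEPENDENCY (page 1, mandatory): continuum YM on T⁴ ⇐ BetaPertH ∧ nine spine estimates (0/9 proved); BetaPertH ⇐ (D1) ∧ (D4) ∧ CAP+tail;
G-an2-4 gates asym, D1 and NE2/3/4.  HONEST FRAMING (cell contract, verbatim): «discharging `BetaPertH` makes Bałaban's UV stability UNCONDITIONAL —
a real constructive-QFT result; it is NOT the continuum limit and NOT the Clay problem.»  THIS MODULE DISCHARGES NOTHING of the wall: finite non-commutative
algebra BY NAME over an3's `PlaquetteWeitzenbock` ∕ `PlaquetteStencil` ∕ `PlaquetteVertex` and H2V-2's `SliceVertex`, one `B`-order above `SliceVertex` §1 — the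
`W`-slot («`sliceW4`», H2V-DESIGN §1) of the BF slice where `SliceVertex` typed the `V`-slot (`sliceVertex₁`, `sEntry`, `sliceA`).  `[our object]`∕`[folklore]`
throughout; nothing cited, no `def … : Prop`, no `sorry`.  NOT the perfect action's jets (H2V-4′), NOT (Kcov), NOT hgerm, NOT D1, NOT BetaPertH, NOT continuum, NOT Clay.

ABSOLUTE RULE (cell charter, verbatim): «No internally-minted statement may enter as a cited fact. Every hypothesis is either kernel-proved in this package or a
verbatim quotation of a PUBLISHED theorem with page reference. The manuscript(s) under audit are NOT citable for their own disputed steps — they are the thing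
under adjudication; programme-internal (2001/route/tribunal) claims are never citable.»  B9 = [Balaban1985BackgroundPropagators] (3.8) (the covariant adjoint
`D*`) is CONTEXT only — where the printed object lives; nothing printed is a hypothesis.

THE OBJECT.  In the cell's parametrisation `U_b = e^{W_b}e^{B_b}` the incoming letter `W_μ(x−e_μ)` is transported to `x` by `Ad(e^{B_μ(x−e_μ)})⁻¹ = e^{−ad B} =
1 − [B, ·] + ½[B,[B, ·]] − …`; an3's `PlaquetteWeitzenbock.covDiv₁ = divW + divTwist` keeps the first transport word (`divTwist = Σ_μ [B_μ, W_μ](x−e_μ)`).  This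
module adds the SECOND transport word `divTwist₂ = −½Σ_μ [B_μ,[B_μ, W_μ]](x−e_μ)` (`twist₂`, polarised in the two background letters), the truncation
`covDiv₂ = covDiv₁ + divTwist₂`, the functional `sliceForm₂ = −½Σ_x τ(covDiv₂²)` and its EXACT grading by `B`-order (`sliceForm₂_eq`): order 0 `−½Στ(divW²)`,
order 1 `−divGerm`, order 2 = **`sliceJet22 := −½Στ(divTwist²) − Στ(divW·divTwist₂)`** (the first word was already inside `sliceForm₁`, the second is new),
orders 3–4 displayed.  Same epistemic status as `covDiv₁`: a DEFINITION of the truncated transport, asserting nothing about B9.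

WHAT IS PROVED.
* §1 RING LEVEL (any `ℝ`-algebra `𝔸`, `ℝ`-linear tracial `τ`, finite periodic `Λ`, frame `e`): the definitions above, `sliceJet22P` (the `(2,2)` jet POLARISED in the
  background, symmetric: `sliceJet22P_comm`), `sliceJet22_eq`, **`sliceForm₂_eq`**.
* §2 COLOUR COORDINATES: the nested colour form **`adM₂ τ t Y₁ Y₂ a b := τ(t_a·[Y₁,[Y₂,t_b]])`** (the second-order sibling of an3's `adM τ t Y a b = τ(Y·[t_a,t_b])`;
  `adM₂_transpose : (adM₂ Y₁ Y₂)ᵀ = adM₂ Y₂ Y₁` for tracial `τ`), the two trace identities `trace_field_mul_brbr_field` (`τ(W_α(x)·[Y₁,[Y₂,W_β(y)]]) =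
  v ⬝ᵥ pairIns x y α β (adM₂ Y₁ Y₂) v`) and `trace_br_field_mul_br_field` (`τ([Y₁,W_α(x)]·[Y₂,W_β(y)]) = −(same)`), the two-bond collapses `divTwist_bondLetter` (an3 ✓)
  and `twist₂_bondLetter₂`, **`sliceVertex₂ e z₁ γ₁ z₂ γ₂ A₁₂ A₂₁`** (the `T₁T₁` word `[z₁+e_{γ₁} = z₂+e_{γ₂}]•pairIns z₁ z₂ γ₁ γ₂ A₁₂` — both background bonds END at
  the same site — plus, on the diagonal `(z₁,γ₁) = (z₂,γ₂)`, the `divW·T₂` words `½Σ_μ (pairIns (z+e_γ) z μ γ − pairIns (z+e_γ−e_μ) z μ γ)(A₁₂ + A₂₁)`), and the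
  `(2,2)` JET IN COORDINATES **`sliceJet22P_field_bondLetter₂ : sliceJet22P τ e (field t v) (bondLetter z₁ γ₁ Y₁) (bondLetter z₂ γ₂ Y₂) = ½ · v ⬝ᵥ (sliceVertex₂ e z₁ γ₁
  z₂ γ₂ (adM₂ τ t Y₁ Y₂) (adM₂ τ t Y₂ Y₁) *ᵥ v)`** (Hessian convention `S₂ = ½·vᵀHv`, as `SliceVertex.sliceJet21_field_bondLetter`).
* §3 PACKED FIBRE (general `d`): the colourless two-bond entry **`sEntry₂ d κ u κ′ u′ x w α β`** := the entry of `sliceVertex₂` at `C := Unit`, `A₁₂ = A₂₁ := 1`,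
  `e := unitVec`, `Λ := ℤ^{d+1}` (the stripping convention of `StepJetData` §5 ∕ `SliceVertex.sEntry`: a colour word is replaced by `1`), CLOSED FORM **`sEntry₂_apply`**:
  `= [u+e_κ = u′+e_{κ′}]·[x=u∧α=κ]·[w=u′∧β=κ′] + [u=u′∧κ=κ′]·([x = u+e_κ] − [x = u+e_κ−e_α])·[w=u∧β=κ]`, and **`sEntry₂_eq_sEntry`**: the same-bond part IS `−½·sEntry d κ u w x β α`
  (the second transport word re-reads the first-order slice entry with the opposite sign and the legs exchanged); `sEntry₂_translate`.
Provenance: D1 formalisation swarm seat b2b-balaban-beta-d1-formalise-leaf-02 gen 10 (road FP engine lineage), 2026-08-21.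
-/

noncomputable section

namespace Summit.QuantumFields.BalabanUV.Beta.FP.SliceVertex2

open Finset
open scoped BigOperators Matrix
open Literature.MathematicalPhysics.QuantumFieldTheory.Balaban1983to89
open Literature.MathematicalPhysics.QuantumFieldTheory.Balaban1983to89.Beta
open Literature.MathematicalPhysics.QuantumFieldTheory.Balaban1983to89.Beta.BubbleTable (elemIns elemIns_apply)
open Literature.MathematicalPhysics.QuantumFieldTheory.Balaban1983to89.Beta.SpinTable (br)
open Literature.MathematicalPhysics.QuantumFieldTheory.Balaban1983to89.Beta.PlaquetteVertex (field adM adM_apply bondLetter br_add_left br_add_right)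
open Literature.MathematicalPhysics.QuantumFieldTheory.Balaban1983to89.Beta.PlaquetteWeitzenbock (divW divTwist divGerm covDiv₁ sum_covDiv₁_sq br_sub_left
  br_sub_right br_sum_right br_zero_left trace_mul_br_cycl)
open Literature.MathematicalPhysics.QuantumFieldTheory.Balaban1983to89.Beta.PlaquetteStencil (dirBlock dirBlock_apply pairIns dotProduct_pairIns_mulVec
  dotProduct_sum_mulVec divTwist_bondLetter)
open B6BondElimination (unitVec unitVec_apply)
open Summit.QuantumFields.BalabanUV.Beta.FP.SliceVertex (sliceForm₁ sliceForm₁_eq sEntry sEntry_apply)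

/-! ## §1 Ring level: the second transport word, `covDiv₂`, `sliceForm₂`, the `(2,2)` jet and the grading of the functional -/

section RingLevel

variable {𝔸 : Type*} [Ring 𝔸] [Algebra ℝ 𝔸]
variable {Λ : Type*} [Fintype Λ] [DecidableEq Λ] [AddCommGroup Λ] {C : Type*} [Fintype C] {D : Type*} [Fintype D] [DecidableEq D]

/-- [our object] **THE NESTED DOUBLE-TWIST WORD, POLARISED IN THE BACKGROUND**: `twist₂ e W B B′ x := Σ_μ [B_μ(x−e_μ), [B′_μ(x−e_μ), W_μ(x−e_μ)]]` — the word of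
`ad_B ad_{B′}` acting on the incoming letters of the bonds ending at `x`.  A definition asserting nothing. -/
def twist₂ (e : D → Λ) (W B B' : Λ → D → 𝔸) (x : Λ) : 𝔸 := ∑ μ, br (B (x - e μ) μ) (br (B' (x - e μ) μ) (W (x - e μ) μ))

/-- [our object] **THE SECOND TRANSPORT WORD OF THE COVARIANT BACKWARD DIVERGENCE**: `divTwist₂ e W B x := −½·twist₂ e W B B x` (the `½ad_B²` term of `e^{−ad B}`, with the
overall sign of `covDiv₁`'s convention `divTwist = +Σ[B, W]`).  A definition asserting nothing. -/
def divTwist₂ (e : D → Λ) (W B : Λ → D → 𝔸) (x : Λ) : 𝔸 := -((2 : ℝ)⁻¹ • twist₂ e W B B x)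

/-- [our object] **THE COVARIANT BACKWARD DIVERGENCE TRUNCATED AT SECOND ORDER IN `B`**: `covDiv₂ := covDiv₁ + divTwist₂`.  A definition asserting nothing. -/
def covDiv₂ (e : D → Λ) (W B : Λ → D → 𝔸) (x : Λ) : 𝔸 := covDiv₁ e W B x + divTwist₂ e W B x

/-- [our object] **THE SLICE FUNCTIONAL TRUNCATED AT SECOND ORDER** `−½·Σ_x τ(covDiv₂ · covDiv₂)` (the sign∕factor of `SliceVertex.sliceForm₁`, `ξ = 1`).  A definition
asserting nothing. -/
def sliceForm₂ (τ : 𝔸 →ₗ[ℝ] ℝ) (e : D → Λ) (W B : Λ → D → 𝔸) : ℝ := -((2 : ℝ)⁻¹ * ∑ x, τ (covDiv₂ e W B x * covDiv₂ e W B x))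

/-- [our object] **THE `(2,2)` JET, POLARISED IN THE BACKGROUND**: `−½Σ_x τ(divTwist(B)·divTwist(B′)) + ¼Σ_x τ(divW·(twist₂ B B′ + twist₂ B′ B))` — bilinear and symmetric in
`(B, B′)`; at `B′ = B` the `B`-bilinear part of `sliceForm₂` (`sliceForm₂_eq`).  A definition asserting nothing. -/
def sliceJet22P (τ : 𝔸 →ₗ[ℝ] ℝ) (e : D → Λ) (W B B' : Λ → D → 𝔸) : ℝ :=
  -((2 : ℝ)⁻¹ * ∑ x, τ (divTwist e W B x * divTwist e W B' x)) + (4 : ℝ)⁻¹ * ∑ x, τ (divW e W x * (twist₂ e W B B' x + twist₂ e W B' B x))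

/-- [our object] **THE `(2,2)` JET** `sliceJet22 τ e W B := sliceJet22P τ e W B B`.  A definition asserting nothing. -/
def sliceJet22 (τ : 𝔸 →ₗ[ℝ] ℝ) (e : D → Λ) (W B : Λ → D → 𝔸) : ℝ := sliceJet22P τ e W B B

omit [DecidableEq Λ] [Fintype C] [DecidableEq D] in
/-- [folklore] the polarised jet is symmetric in the two background letters (traciality of `τ`). -/
theorem sliceJet22P_comm (τ : 𝔸 →ₗ[ℝ] ℝ) (hτ : ∀ a b : 𝔸, τ (a * b) = τ (b * a)) (e : D → Λ) (W B B' : Λ → D → 𝔸) :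
    sliceJet22P τ e W B B' = sliceJet22P τ e W B' B := by
  unfold sliceJet22P
  congr 1
  · congr 2
    exact Finset.sum_congr rfl fun x _ => hτ _ _
  · congr 1
    exact Finset.sum_congr rfl fun x _ => by rw [add_comm]

omit [DecidableEq Λ] [Fintype C] [DecidableEq D] in
/-- [folklore] **THE `(2,2)` JET UNPOLARISED**: `sliceJet22 = −½Σ_x τ(divTwist²) − Σ_x τ(divW·divTwist₂)`. -/
theorem sliceJet22_eq (τ : 𝔸 →ₗ[ℝ] ℝ) (e : D → Λ) (W B : Λ → D → 𝔸) :
    sliceJet22 τ e W B = -((2 : ℝ)⁻¹ * ∑ x, τ (divTwist e W B x * divTwist e W B x)) - ∑ x, τ (divW e W x * divTwist₂ e W B x) := by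
  unfold sliceJet22 sliceJet22P divTwist₂
  have e1 : ∀ x, τ (divW e W x * (twist₂ e W B B x + twist₂ e W B B x)) = 2 * τ (divW e W x * twist₂ e W B B x) := by
    intro x; rw [mul_add, map_add, two_mul]
  have e2 : ∀ x, τ (divW e W x * -((2 : ℝ)⁻¹ • twist₂ e W B B x)) = -((2 : ℝ)⁻¹ * τ (divW e W x * twist₂ e W B B x)) := by
    intro x; rw [mul_neg, map_neg, mul_smul_comm, map_smul, smul_eq_mul]
  simp only [e1, e2, Finset.sum_neg_distrib, ← Finset.mul_sum]
  ring

omit [DecidableEq Λ] [Fintype C] [DecidableEq D] in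
/-- [folklore] **THE GRADING OF THE TRUNCATED SLICE FUNCTIONAL BY BACKGROUND ORDER**: `sliceForm₂ = −½Στ(divW²)` (order 0) `− divGerm` (order 1) `+ sliceJet22` (order 2)
`+ (−Στ(divTwist·divTwist₂) − ½Στ(divTwist₂²))` (orders 3, 4) — `sliceJet22` IS the `B`-bilinear part; its first word `−½Στ(divTwist²)` was the last term of
`SliceVertex.sliceForm₁_eq`, its second word `−Στ(divW·divTwist₂)` is the new cross term. -/
theorem sliceForm₂_eq (τ : 𝔸 →ₗ[ℝ] ℝ) (hτ : ∀ a b : 𝔸, τ (a * b) = τ (b * a)) (e : D → Λ) (W B : Λ → D → 𝔸) :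
    sliceForm₂ τ e W B =
      -((2 : ℝ)⁻¹ * ∑ x, τ (divW e W x * divW e W x)) - divGerm τ e W B + sliceJet22 τ e W B
        + (-(∑ x, τ (divTwist e W B x * divTwist₂ e W B x)) - (2 : ℝ)⁻¹ * ∑ x, τ (divTwist₂ e W B x * divTwist₂ e W B x)) := by
  have h1 : sliceForm₁ τ e W B = -((2 : ℝ)⁻¹ * ∑ x, τ (covDiv₁ e W B x * covDiv₁ e W B x)) := rfl
  have h2 := sliceForm₁_eq τ hτ e W B
  rw [sliceJet22_eq, sliceForm₂]
  have e3 : ∀ x, τ (covDiv₂ e W B x * covDiv₂ e W B x) = τ (covDiv₁ e W B x * covDiv₁ e W B x)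
      + 2 * (τ (divW e W x * divTwist₂ e W B x) + τ (divTwist e W B x * divTwist₂ e W B x)) + τ (divTwist₂ e W B x * divTwist₂ e W B x) := by
    intro x
    simp only [covDiv₂, covDiv₁, add_mul, mul_add, map_add]
    rw [hτ (divTwist₂ e W B x) (divW e W x), hτ (divTwist₂ e W B x) (divTwist e W B x)]
    ring
  simp only [e3, Finset.sum_add_distrib, ← Finset.mul_sum]
  rw [h1] at h2
  linear_combination h2

end RingLevel

/-! ## §2 Colour coordinates: the nested colour form `adM₂`, the two trace identities, the two-bond collapse, the vertex `sliceVertex₂` -/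

section Colour

variable {𝔸 : Type*} [Ring 𝔸] [Algebra ℝ 𝔸] {C : Type*} [Fintype C]

/-- [our object] **THE NESTED COLOUR FORM** `adM₂ τ t Y₁ Y₂ a b := τ(t_a · [Y₁, [Y₂, t_b]])` — the colour matrix of the second transport word (sibling of an3's
`adM τ t Y a b = τ(Y·[t_a, t_b])`).  A definition asserting nothing. -/
def adM₂ (τ : 𝔸 →ₗ[ℝ] ℝ) (t : C → 𝔸) (Y₁ Y₂ : 𝔸) : Matrix C C ℝ := Matrix.of fun a b => τ (t a * br Y₁ (br Y₂ (t b)))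

omit [Fintype C] in
/-- [folklore] entries of `adM₂`. -/
@[simp] theorem adM₂_apply (τ : 𝔸 →ₗ[ℝ] ℝ) (t : C → 𝔸) (Y₁ Y₂ : 𝔸) (a b : C) : adM₂ τ t Y₁ Y₂ a b = τ (t a * br Y₁ (br Y₂ (t b))) := rfl

/-- [folklore] **MOVING A BRACKET ACROSS A TRACIAL `τ`**: `τ([Y, X]·Z) = −τ(X·[Y, Z])`. -/
theorem trace_br_mul (τ : 𝔸 →ₗ[ℝ] ℝ) (hτ : ∀ a b : 𝔸, τ (a * b) = τ (b * a)) (Y X Z : 𝔸) : τ (br Y X * Z) = -τ (X * br Y Z) := by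
  simp only [br, sub_mul, mul_sub, map_sub]
  rw [mul_assoc, hτ Y (X * Z), mul_assoc, mul_assoc]
  ring

omit [Fintype C] in
/-- [folklore] `(adM₂ Y₁ Y₂)ᵀ = adM₂ Y₂ Y₁` for tracial `τ` (the bracket moved twice). -/
theorem adM₂_transpose (τ : 𝔸 →ₗ[ℝ] ℝ) (hτ : ∀ a b : 𝔸, τ (a * b) = τ (b * a)) (t : C → 𝔸) (Y₁ Y₂ : 𝔸) :
    (adM₂ τ t Y₁ Y₂)ᵀ = adM₂ τ t Y₂ Y₁ := by
  ext a b
  rw [Matrix.transpose_apply, adM₂_apply, adM₂_apply, hτ (t b), trace_br_mul τ hτ, trace_br_mul τ hτ, neg_neg]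

/-- [folklore] a bracket against a coordinate combination: `[Y, Σ_b c_b t_b] = Σ_b c_b [Y, t_b]`. -/
theorem br_sum_smul_right (Y : 𝔸) (t : C → 𝔸) (c : C → ℝ) : br Y (∑ b, c b • t b) = ∑ b, c b • br Y (t b) := by
  simp only [br, Finset.mul_sum, Finset.sum_mul, mul_smul_comm, smul_mul_assoc, ← Finset.sum_sub_distrib, ← smul_sub]

variable {Λ : Type*} [DecidableEq Λ] {D : Type*} [Fintype D] [DecidableEq D]

/-- [folklore] **`τ(W_α(x) · [Y₁,[Y₂, W_β(y)]]) = v ⬝ᵥ (pairIns x y α β (adM₂ τ t Y₁ Y₂)) v`** — the second-order sibling of `PlaquetteStencil.trace_br_field_field`. -/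
theorem trace_field_mul_brbr_field [Fintype Λ] (τ : 𝔸 →ₗ[ℝ] ℝ) (t : C → 𝔸) (v : Λ × (C × D) → ℝ) (Y₁ Y₂ : 𝔸) (x y : Λ) (α β : D) :
    τ (field t v x α * br Y₁ (br Y₂ (field t v y β))) = v ⬝ᵥ (pairIns x y α β (adM₂ τ t Y₁ Y₂) *ᵥ v) := by
  rw [dotProduct_pairIns_mulVec]
  simp only [field]
  rw [br_sum_smul_right, br_sum_smul_right, Finset.sum_mul, map_sum]
  refine Finset.sum_congr rfl fun a _ => ?_
  rw [Finset.mul_sum, map_sum]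
  refine Finset.sum_congr rfl fun b _ => ?_
  rw [smul_mul_assoc, mul_smul_comm, map_smul, map_smul, smul_eq_mul, smul_eq_mul, adM₂_apply]
  ring

/-- [folklore] **`τ([Y₁, W_α(x)] · [Y₂, W_β(y)]) = −v ⬝ᵥ (pairIns x y α β (adM₂ τ t Y₁ Y₂)) v`** (tracial `τ`: `trace_br_mul`). -/
theorem trace_br_field_mul_br_field [Fintype Λ] (τ : 𝔸 →ₗ[ℝ] ℝ) (hτ : ∀ a b : 𝔸, τ (a * b) = τ (b * a)) (t : C → 𝔸)
    (v : Λ × (C × D) → ℝ) (Y₁ Y₂ : 𝔸) (x y : Λ) (α β : D) :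
    τ (br Y₁ (field t v x α) * br Y₂ (field t v y β)) = -(v ⬝ᵥ (pairIns x y α β (adM₂ τ t Y₁ Y₂) *ᵥ v)) := by
  rw [trace_br_mul τ hτ, trace_field_mul_brbr_field]

variable [AddCommGroup Λ]

omit [Algebra ℝ 𝔸] [Fintype C] in
/-- [folklore] **THE DOUBLE TWIST AT TWO BOND LETTERS** lives on the diagonal: `twist₂ e W (bondLetter z₁ γ₁ Y₁) (bondLetter z₂ γ₂ Y₂) x = [(z₁,γ₁) = (z₂,γ₂)]·[x = z₁+e_{γ₁}]·
[Y₁,[Y₂, W_{γ₁}(z₁)]]`. -/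
theorem twist₂_bondLetter₂ (e : D → Λ) (W : Λ → D → 𝔸) (z₁ : Λ) (γ₁ : D) (Y₁ : 𝔸) (z₂ : Λ) (γ₂ : D) (Y₂ : 𝔸) (x : Λ) :
    twist₂ e W (bondLetter z₁ γ₁ Y₁) (bondLetter z₂ γ₂ Y₂) x =
      if (z₁ = z₂ ∧ γ₁ = γ₂) ∧ x = z₁ + e γ₁ then br Y₁ (br Y₂ (W z₁ γ₁)) else 0 := by
  simp only [twist₂, bondLetter]
  by_cases h : (z₁ = z₂ ∧ γ₁ = γ₂) ∧ x = z₁ + e γ₁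
  · obtain ⟨⟨rfl, rfl⟩, rfl⟩ := h
    rw [if_pos ⟨⟨rfl, rfl⟩, rfl⟩, Finset.sum_eq_single_of_mem γ₁ (Finset.mem_univ γ₁)]
    · rw [if_pos ⟨by rw [add_sub_cancel_right], rfl⟩, if_pos ⟨by rw [add_sub_cancel_right], rfl⟩, add_sub_cancel_right]
    · intro μ _ hμ
      rw [if_neg (fun h => hμ h.2), br_zero_left]
  · rw [if_neg h]
    refine Finset.sum_eq_zero fun μ _ => ?_
    by_cases h1 : x - e μ = z₁ ∧ μ = γ₁
    · by_cases h2 : x - e μ = z₂ ∧ μ = γ₂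
      · exact absurd ⟨⟨h1.1.symm.trans h2.1, h1.2.symm.trans h2.2⟩, by rw [← h1.1, h1.2, sub_add_cancel]⟩ h
      · rw [if_neg h2, br_zero_left, br]; simp
    · rw [if_neg h1, br_zero_left]

end Colour

section Vertex

variable {Λ : Type*} [DecidableEq Λ] [AddCommGroup Λ] {C : Type*} {D : Type*} [Fintype D] [DecidableEq D]

/-- [our object] **THE TWO-BOND SLICE VERTEX** at background bonds `(z₁,γ₁)`, `(z₂,γ₂)` with colour slots `A₁₂` (word `Y₁Y₂`) and `A₂₁` (word `Y₂Y₁`): the `T₁T₁` word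
`[z₁+e_{γ₁} = z₂+e_{γ₂}]•pairIns z₁ z₂ γ₁ γ₂ A₁₂` (the two background bonds END at the same site; row leg pinned at bond 1, column leg at bond 2) plus, on the
DIAGONAL `(z₁,γ₁) = (z₂,γ₂)`, the `divW·T₂` words `½Σ_μ (pairIns (z₁+e_{γ₁}) z₁ μ γ₁ − pairIns (z₁+e_{γ₁}−e_μ) z₁ μ γ₁)(A₁₂) + (same)(A₂₁)` (row leg = the backward
divergence at the far endpoint, column leg pinned).  Convention `sliceJet22P = ½·vᵀMv` (`sliceJet22P_field_bondLetter₂`).  A definition asserting nothing. -/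
def sliceVertex₂ (e : D → Λ) (z₁ : Λ) (γ₁ : D) (z₂ : Λ) (γ₂ : D) (A₁₂ A₂₁ : Matrix C C ℝ) : Matrix (Λ × (C × D)) (Λ × (C × D)) ℝ :=
  (if z₁ + e γ₁ = z₂ + e γ₂ then (1 : ℝ) else 0) • pairIns z₁ z₂ γ₁ γ₂ A₁₂
    + (if z₁ = z₂ ∧ γ₁ = γ₂ then (2 : ℝ)⁻¹ else 0) •
        ∑ μ, ((pairIns (z₁ + e γ₁) z₁ μ γ₁ A₁₂ - pairIns (z₁ + e γ₁ - e μ) z₁ μ γ₁ A₁₂)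
          + (pairIns (z₁ + e γ₁) z₁ μ γ₁ A₂₁ - pairIns (z₁ + e γ₁ - e μ) z₁ μ γ₁ A₂₁))

end Vertex

section Jet22

variable {𝔸 : Type*} [Ring 𝔸] [Algebra ℝ 𝔸]
variable {Λ : Type*} [Fintype Λ] [DecidableEq Λ] [AddCommGroup Λ] {C : Type*} [Fintype C] {D : Type*} [Fintype D] [DecidableEq D]

omit [AddCommGroup Λ] [DecidableEq D] in
/-- [folklore] bookkeeping: a sum of products of two one-site indicators. -/
theorem sum_ite_mul_ite (τ : 𝔸 →ₗ[ℝ] ℝ) (p q : Λ) (X Z : 𝔸) :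
    ∑ x, τ ((if x = p then X else 0) * (if x = q then Z else 0)) = if p = q then τ (X * Z) else 0 := by
  rw [Finset.sum_eq_single_of_mem p (Finset.mem_univ p)]
  · rw [if_pos rfl]
    by_cases h : p = q
    · rw [if_pos h, if_pos h]
    · rw [if_neg h, if_neg h, mul_zero, map_zero]
  · intro x _ hx
    rw [if_neg hx, zero_mul, map_zero]

omit [AddCommGroup Λ] [DecidableEq D] in
/-- [folklore] bookkeeping: a sum against one one-site indicator. -/
theorem sum_mul_ite (τ : 𝔸 →ₗ[ℝ] ℝ) (F : Λ → 𝔸) (c : Prop) [Decidable c] (p : Λ) (Z : 𝔸) :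
    ∑ x, τ (F x * (if c ∧ x = p then Z else 0)) = if c then τ (F p * Z) else 0 := by
  by_cases hc : c
  · simp only [hc, true_and, if_true]
    rw [Finset.sum_eq_single_of_mem p (Finset.mem_univ p)]
    · rw [if_pos rfl]
    · intro x _ hx; rw [if_neg hx, mul_zero, map_zero]
  · simp [hc]

/-- [folklore] **THE `(2,2)` JET OF THE SLICE IN COORDINATES**: at the two bond letters `(z₁,γ₁,Y₁)`, `(z₂,γ₂,Y₂)`, for every fluctuation in coordinates `v` and every
tracial `τ`, `sliceJet22P τ e (field t v) (bondLetter z₁ γ₁ Y₁) (bondLetter z₂ γ₂ Y₂) = ½ · v ⬝ᵥ (sliceVertex₂ e z₁ γ₁ z₂ γ₂ (adM₂ τ t Y₁ Y₂) (adM₂ τ t Y₂ Y₁) *ᵥ v)`. -/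
theorem sliceJet22P_field_bondLetter₂ (τ : 𝔸 →ₗ[ℝ] ℝ) (hτ : ∀ a b : 𝔸, τ (a * b) = τ (b * a)) (t : C → 𝔸) (e : D → Λ)
    (v : Λ × (C × D) → ℝ) (z₁ : Λ) (γ₁ : D) (Y₁ : 𝔸) (z₂ : Λ) (γ₂ : D) (Y₂ : 𝔸) :
    sliceJet22P τ e (field t v) (bondLetter z₁ γ₁ Y₁) (bondLetter z₂ γ₂ Y₂) =
      (2 : ℝ)⁻¹ * (v ⬝ᵥ (sliceVertex₂ e z₁ γ₁ z₂ γ₂ (adM₂ τ t Y₁ Y₂) (adM₂ τ t Y₂ Y₁) *ᵥ v)) := by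
  unfold sliceJet22P
  simp only [divTwist_bondLetter, twist₂_bondLetter₂]
  rw [sum_ite_mul_ite, trace_br_field_mul_br_field τ hτ]
  have hswap : ∀ x, (if (z₂ = z₁ ∧ γ₂ = γ₁) ∧ x = z₂ + e γ₂ then br Y₂ (br Y₁ (field t v z₂ γ₂)) else 0)
      = (if (z₁ = z₂ ∧ γ₁ = γ₂) ∧ x = z₁ + e γ₁ then br Y₂ (br Y₁ (field t v z₁ γ₁)) else 0) := by
    intro x
    by_cases h : z₁ = z₂ ∧ γ₁ = γ₂
    · obtain ⟨rfl, rfl⟩ := h; rfl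
    · rw [if_neg (fun h' => h ⟨h'.1.1.symm, h'.1.2.symm⟩), if_neg (fun h' => h h'.1)]
  simp only [hswap, mul_add, map_add, Finset.sum_add_distrib]
  rw [sum_mul_ite, sum_mul_ite]
  -- the divergence at the far endpoint against the nested bracket, in coordinates
  have hdiv : ∀ (Ya Yb : 𝔸), τ (divW e (field t v) (z₁ + e γ₁) * br Ya (br Yb (field t v z₁ γ₁))) =
      ∑ μ, (v ⬝ᵥ (pairIns (z₁ + e γ₁) z₁ μ γ₁ (adM₂ τ t Ya Yb) *ᵥ v) - v ⬝ᵥ (pairIns (z₁ + e γ₁ - e μ) z₁ μ γ₁ (adM₂ τ t Ya Yb) *ᵥ v)) := by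
    intro Ya Yb
    rw [divW, Finset.sum_mul, map_sum]
    refine Finset.sum_congr rfl fun μ _ => ?_
    rw [sub_mul, map_sub, trace_field_mul_brbr_field, trace_field_mul_brbr_field]
  -- the matrix side
  rw [sliceVertex₂, Matrix.add_mulVec, dotProduct_add, Matrix.smul_mulVec, dotProduct_smul, Matrix.smul_mulVec, dotProduct_smul, smul_eq_mul, smul_eq_mul,
    dotProduct_sum_mulVec]
  simp only [Matrix.add_mulVec, Matrix.sub_mulVec, dotProduct_add, dotProduct_sub]
  by_cases h12 : z₁ = z₂ ∧ γ₁ = γ₂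
  · rw [if_pos h12, if_pos h12, if_pos h12, hdiv, hdiv]
    simp only [Finset.sum_add_distrib, Finset.sum_sub_distrib]
    split_ifs <;> ring
  · rw [if_neg h12, if_neg h12, if_neg h12]
    split_ifs <;> ring

end Jet22

/-! ## §3 The colourless two-bond entry `sEntry₂` on `ℤ^{d+1}` in closed form -/

section Packed

variable {d : ℕ}

/-- [our object] **THE COLOURLESS TWO-BOND ENTRY** of the slice's second-order vertex: `sliceVertex₂` at `C := Unit`, `A₁₂ = A₂₁ := 1`, `e := unitVec`, `Λ := ℤ^{d+1}`,
background bonds `(κ, u)`, `(κ′, u′)`, row `(x, α)`, column `(w, β)` — the stripping convention of `StepJetData` §5 ∕ `SliceVertex.sEntry` one order up (both colour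
words `Y₁Y₂`, `Y₂Y₁` replaced by `1`).  A definition asserting nothing. -/
def sEntry₂ (d : ℕ) (κ : Fin (d + 1)) (u : Fin (d + 1) → ℤ) (κ' : Fin (d + 1)) (u' : Fin (d + 1) → ℤ) (x w : Fin (d + 1) → ℤ) (α β : Fin (d + 1)) : ℝ :=
  sliceVertex₂ (C := Unit) (unitVec (d := d + 1)) u κ u' κ' (1 : Matrix Unit Unit ℝ) 1 (x, ((), α)) (w, ((), β))

/-- [folklore] entries of a colourless located pair on `ℤ^{d+1}`. -/
theorem pairIns_one_apply (p q x w : Fin (d + 1) → ℤ) (μ ν α β : Fin (d + 1)) :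
    pairIns (C := Unit) p q μ ν (1 : Matrix Unit Unit ℝ) (x, ((), α)) (w, ((), β)) = if (x = p ∧ α = μ) ∧ (w = q ∧ β = ν) then 1 else 0 := by
  rw [pairIns, elemIns_apply, dirBlock_apply, Matrix.one_apply_eq]
  by_cases h1 : x = p <;> by_cases h2 : w = q <;> by_cases h3 : α = μ <;> by_cases h4 : β = ν <;> simp [h1, h2, h3, h4]

/-- [folklore] **CLOSED FORM**: `sEntry₂ d κ u κ′ u′ x w α β = [u+e_κ = u′+e_{κ′}]·[x=u∧α=κ]·[w=u′∧β=κ′] + [u=u′∧κ=κ′]·([x = u+e_κ] − [x = u+e_κ−e_α])·[w=u∧β=κ]`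
— the `T₁T₁` word pins both legs at the two background bonds (which must END at the same site); the same-bond `divW·T₂` word pins the column leg at the bond and
reads the backward divergence of the row leg at the far endpoint `u + e_κ`. -/
theorem sEntry₂_apply (κ : Fin (d + 1)) (u : Fin (d + 1) → ℤ) (κ' : Fin (d + 1)) (u' : Fin (d + 1) → ℤ) (x w : Fin (d + 1) → ℤ) (α β : Fin (d + 1)) :
    sEntry₂ d κ u κ' u' x w α β =
      (if u + unitVec κ = u' + unitVec κ' then (1 : ℝ) else 0) * (if x = u ∧ α = κ then 1 else 0) * (if w = u' ∧ β = κ' then 1 else 0)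
        + (if u = u' ∧ κ = κ' then (1 : ℝ) else 0) *
            ((if x = u + unitVec κ then 1 else 0) - (if x = u + unitVec κ - unitVec α then 1 else 0)) * (if w = u ∧ β = κ then 1 else 0) := by
  have split : ∀ (P Q : Prop) [Decidable P] [Decidable Q], (if P ∧ Q then (1 : ℝ) else 0) = (if P then 1 else 0) * (if Q then 1 else 0) := by
    intro P Q _ _
    by_cases p : P <;> by_cases q : Q <;> simp [p, q]
  unfold sEntry₂ sliceVertex₂
  rw [Matrix.add_apply, Matrix.smul_apply, Matrix.smul_apply, smul_eq_mul, smul_eq_mul, Matrix.sum_apply, pairIns_one_apply]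
  simp only [Matrix.add_apply, Matrix.sub_apply, pairIns_one_apply]
  rw [Finset.sum_eq_single_of_mem α (Finset.mem_univ α) (fun μ _ hμ => by
    rw [if_neg (fun h => hμ h.1.2.symm), if_neg (fun h => hμ h.1.2.symm)]; ring)]
  by_cases hb : u = u' ∧ κ = κ'
  · simp only [if_pos hb, and_true, split]
    ring
  · simp only [if_neg hb, and_true, split]
    ring

/-- [folklore] **THE SAME-BOND WORD IS MINUS ONE HALF OF THE FIRST-ORDER SLICE ENTRY WITH THE LEGS EXCHANGED**:
`sEntry₂ d κ u κ′ u′ x w α β = [u+e_κ = u′+e_{κ′}]·[x=u∧α=κ]·[w=u′∧β=κ′] − [u=u′∧κ=κ′]·½·sEntry d κ u w x β α` (`SliceVertex.sEntry_apply`: `sEntry d κ u w x β α =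
−2·[w=u∧β=κ]·([x = u+e_κ] − [x = u+e_κ−e_α])`) — the `½ad_B²` transport word re-reads the `−ad_B` word. -/
theorem sEntry₂_eq_sEntry (κ : Fin (d + 1)) (u : Fin (d + 1) → ℤ) (κ' : Fin (d + 1)) (u' : Fin (d + 1) → ℤ) (x w : Fin (d + 1) → ℤ) (α β : Fin (d + 1)) :
    sEntry₂ d κ u κ' u' x w α β =
      (if u + unitVec κ = u' + unitVec κ' then (1 : ℝ) else 0) * (if x = u ∧ α = κ then 1 else 0) * (if w = u' ∧ β = κ' then 1 else 0)
        - (2 : ℝ)⁻¹ * (if u = u' ∧ κ = κ' then (1 : ℝ) else 0) * sEntry d κ u w x β α := by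
  rw [sEntry₂_apply, sEntry_apply]
  by_cases hw : w = u ∧ β = κ
  · simp only [if_pos hw, mul_one]; ring
  · simp only [if_neg hw, mul_zero]; ring

/-- [folklore] **FINE-TRANSLATION COVARIANCE** of the two-bond entry: translating both background bonds by `v` translates both legs. -/
theorem sEntry₂_translate (κ : Fin (d + 1)) (u : Fin (d + 1) → ℤ) (κ' : Fin (d + 1)) (u' v x w : Fin (d + 1) → ℤ) (α β : Fin (d + 1)) :
    sEntry₂ d κ (u + v) κ' (u' + v) x w α β = sEntry₂ d κ u κ' u' (x - v) (w - v) α β := by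
  simp only [sEntry₂_apply]
  have e1 : (u + v + unitVec κ = u' + v + unitVec κ') ↔ (u + unitVec κ = u' + unitVec κ') :=
    ⟨fun h => by linear_combination h, fun h => by linear_combination h⟩
  have e2 : (x = u + v ∧ α = κ) ↔ (x - v = u ∧ α = κ) :=
    and_congr_left' ⟨fun h => by linear_combination h, fun h => by linear_combination h⟩
  have e3 : (w = u' + v ∧ β = κ') ↔ (w - v = u' ∧ β = κ') :=
    and_congr_left' ⟨fun h => by linear_combination h, fun h => by linear_combination h⟩
  have e4 : (u + v = u' + v ∧ κ = κ') ↔ (u = u' ∧ κ = κ') :=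
    and_congr_left' ⟨fun h => by linear_combination h, fun h => by linear_combination h⟩
  have e5 : (x = u + v + unitVec κ) ↔ (x - v = u + unitVec κ) :=
    ⟨fun h => by linear_combination h, fun h => by linear_combination h⟩
  have e6 : (x = u + v + unitVec κ - unitVec α) ↔ (x - v = u + unitVec κ - unitVec α) :=
    ⟨fun h => by linear_combination h, fun h => by linear_combination h⟩
  have e7 : (w = u + v ∧ β = κ) ↔ (w - v = u ∧ β = κ) :=
    and_congr_left' ⟨fun h => by linear_combination h, fun h => by linear_combination h⟩
  simp only [e1, e2, e3, e4, e5, e6, e7]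

end Packed

end Summit.QuantumFields.BalabanUV.Beta.FP.SliceVertex2

end
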